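import Summits.AtomisticToContinuum.FouriersLaw.Theorems.EmbeddedDrudeMourreDrudeDissolutionStubGramContinuityUniformMoments
import HarnessLib

/-!
# Stub G `stub_gramContinuity`, tool 7: expectations of local polynomials are continuous in the
coupling (line `gram-pencil-harmonic-chaos`, crux `EmbeddedDrudeMourre.DrudeDissolution`,
item stmt-AtomisticToContinuum-12593; `--supports` file, closes nothing)

WHAT. For `ω₂ > 0`, `a, b ≥ 0`, any family `ε ↦ μ_ε` of shift-invariant DLR states at `T = 1` of
`pinnedChain ω₂ (aε) (bε) 1` and every local polynomial `F ∈ 𝒫`, the map `ε ↦ ∫ F dμ_ε` is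
continuous on `[0, 1]` (`pencil_expectation_continuous`, registered sub-goal of stub G): the
finite-dimensional marginals of THE thermal state of the ray depend continuously on the coupling,
harmonic endpoint included — the termwise input of clause (iii) of stub G.

PROOF. (A) For a BOUNDED measurable `G` depending on a window, `∫ G dμ_ε` is the Lebesgue integral
of `G` against the explicit Markov window density of `pencil_markov_state` (tool 5), continuous in
`ε` pointwise (the Jentzsch eigenfunction and eigenvalue are continuous in `ε`) and dominated by
`‖G‖_∞ B² λ_min⁻ⁿ ∏ w₀` (`w₀` the Gaussian one-site weight) — dominated convergence. (B) A local
polynomial is approximated by its truncations `(-N) ∨ F ∧ N` with error `≤ ∫ F²/N`, uniform in `ε`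
by `pencil_uniform_moments` (tool 6); a uniform limit of continuous functions is continuous.
-/

noncomputable section

open MeasureTheory Set Filter Function Topology
open scoped InnerProductSpace ENNReal
open Literature.MathematicalPhysics.KineticTheory
open Literature.MathematicalPhysics.KineticTheory.HeatConduction
open Literature.MathematicalPhysics.KineticTheory.HeatConduction.OscillatorChain

namespace Summit.AtomisticToContinuum.FouriersLaw.Theorems.DrudeDissolution.GramPencilHarmonicChaos

/-- Every local polynomial observable depends on the sites of a centred box. [folklore] -/
theorem exists_dependsOn_of_mem_polyObs {f : ChainConfig → ℝ}
    (hf : f ∈ Algebra.adjoin ℝ (Set.range fun xc : ℤ × Bool =>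
      fun σ : ChainConfig => if xc.2 then (σ xc.1).2 else (σ xc.1).1)) :
    ∃ R : ℕ, DependsOn f (Set.Icc (-(R : ℤ)) R) := by
  induction hf using Algebra.adjoin_induction with
  | mem f hf =>
    obtain ⟨⟨x, bb⟩, rfl⟩ := hf
    refine ⟨x.natAbs, fun σ τ hστ => ?_⟩
    have hx : x ∈ Set.Icc (-(x.natAbs : ℤ)) x.natAbs := by
      simp only [Set.mem_Icc]; omega
    dsimp only
    rw [hστ x hx]
  | algebraMap r => exact ⟨0, fun σ τ _ => rfl⟩
  | add f₁ f₂ _ _ ih₁ ih₂ =>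
    obtain ⟨R₁, h₁⟩ := ih₁
    obtain ⟨R₂, h₂⟩ := ih₂
    refine ⟨max R₁ R₂, fun σ τ hστ => ?_⟩
    rw [Pi.add_apply, Pi.add_apply,
      h₁ fun i hi => hστ i (Set.Icc_subset_Icc (by simp) (by simp) hi),
      h₂ fun i hi => hστ i (Set.Icc_subset_Icc (by simp) (by simp) hi)]
  | mul f₁ f₂ _ _ ih₁ ih₂ =>
    obtain ⟨R₁, h₁⟩ := ih₁
    obtain ⟨R₂, h₂⟩ := ih₂
    refine ⟨max R₁ R₂, fun σ τ hστ => ?_⟩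
    rw [Pi.mul_apply, Pi.mul_apply,
      h₁ fun i hi => hστ i (Set.Icc_subset_Icc (by simp) (by simp) hi),
      h₂ fun i hi => hστ i (Set.Icc_subset_Icc (by simp) (by simp) hi)]

/-- The truncation error `|t - (-N ∨ t ∧ N)| ≤ t²/N`. [folklore] -/
theorem abs_sub_clamp_le (t : ℝ) {N : ℝ} (hN : 0 < N) :
    |t - max (-N) (min t N)| ≤ |t| ^ 2 / N := by
  rw [sq_abs, le_div_iff₀ hN]
  rcases le_total t N with h1 | h1
  · rw [min_eq_left h1]
    rcases le_total (-N) t with h2 | h2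
    · rw [max_eq_right h2, sub_self, abs_zero, zero_mul]; positivity
    · rw [max_eq_left h2, abs_of_nonpos (by linarith)]
      nlinarith
  · rw [min_eq_right h1, max_eq_right (by linarith), abs_of_nonneg (by linarith)]
    nlinarith

/-- **(A) Bounded local observables have expectations continuous in the coupling.** [folklore] -/
theorem continuousOn_integral_of_bounded {ω₂ a b : ℝ} (hω : 0 < ω₂) (ha : 0 ≤ a) (hb : 0 ≤ b)
    {μ : ℝ → Measure ChainConfig}
    (hμ : ∀ ε ∈ Set.Icc (0 : ℝ) 1, (pinnedChain ω₂ (a * ε) (b * ε) 1).IsChainGibbsMeasure 1 (μ ε) ∧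
      IsShiftInvariant (μ ε)) {G : ChainConfig → ℝ} {R : ℕ} {MG : ℝ} (hGm : Measurable G)
    (hGd : DependsOn G (Set.Icc (-(R : ℤ)) R)) (hG0 : ∀ σ, 0 ≤ G σ) (hGb : ∀ σ, G σ ≤ MG) :
    ContinuousOn (fun ε => ∫ σ, G σ ∂(μ ε)) (Set.Icc 0 1) := by
  classical
  obtain ⟨lam, h, B, m, lmin, -, hlmin, hlamc, hhc, hall⟩ := pencil_markov_state' hω ha hb
  set S : Set ℝ := Set.Icc 0 1 with hS
  set a₀ : ℤ := -(R : ℤ) with ha₀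
  set n : ℕ := 2 * R with hn
  set W : Finset ℤ := Finset.Icc a₀ (a₀ + n) with hW
  have hWset : (↑W : Set ℤ) = Set.Icc (-(R : ℤ)) R := by
    rw [hW, Finset.coe_Icc, ha₀, hn]; push_cast; congr 1; ring
  have hGdW : DependsOn (fun σ => ENNReal.ofReal (G σ)) (↑W : Set ℤ) := by
    rw [hWset]; exact fun σ τ hστ => by dsimp only; rw [hGd hστ]
  have hGm' : Measurable fun σ => ENNReal.ofReal (G σ) := ENNReal.measurable_ofReal.comp hGm
  set η₀ : ChainConfig := fun _ => (0, 0) with hη₀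
  -- the real window density
  set dR : ℝ → ChainConfig → ℝ := fun ε σ => h ε (σ a₀) * h ε (σ (a₀ + n)) *
    (∏ j ∈ Finset.range n, Real.exp (-(1 : ℝ)⁻¹ * (pinnedChain ω₂ (a * ε) (b * ε) 1).V
      ((σ (a₀ + j + 1)).1 - (σ (a₀ + j)).1)) * (lam ε)⁻¹) *
    ∏ j ∈ Finset.range (n + 1), Real.exp (-(1 : ℝ)⁻¹ * ((σ (a₀ + j)).2 ^ 2 / 2 +
      (pinnedChain ω₂ (a * ε) (b * ε) 1).U (σ (a₀ + j)).1)) with hdR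
  -- the Gaussian reference one-site weight
  set w0r : ℝ × ℝ → ℝ := fun z => Real.exp (-(1 : ℝ)⁻¹ * (z.2 ^ 2 / 2 + (pinnedChain ω₂ 0 0 1).U z.1))
    with hw0r
  set w0 : ℝ × ℝ → ℝ≥0∞ := fun z => ENNReal.ofReal (w0r z) with hw0
  have hw0rc : Continuous w0r := by
    rw [hw0r]
    show Continuous fun z : ℝ × ℝ => Real.exp (-(1 : ℝ)⁻¹ * (z.2 ^ 2 / 2 + (ω₂ * z.1 ^ 2 / 2 + 0 * z.1 ^ 4 / 4)))
    fun_prop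
  have hw0m : Measurable w0 := ENNReal.measurable_ofReal.comp hw0rc.measurable
  have hw0i : ∫⁻ z, w0 z ≠ ∞ := by
    have hint : Integrable w0r := (pinnedChain ω₂ 0 0 1).integrable_siteWeight one_pos
      (integrable_exp_neg_pinning one_pos hω le_rfl 0 1)
    exact ((hasFiniteIntegral_iff_ofReal (Eventually.of_forall fun z => (Real.exp_pos _).le)).1
      hint.hasFiniteIntegral).ne
  -- coordinates are measurable
  have hq : ∀ i : ℤ, Measurable fun σ : ChainConfig => (σ i).1 := fun i => (measurable_pi_apply i).fst
  have hp : ∀ i : ℤ, Measurable fun σ : ChainConfig => (σ i).2 := fun i => (measurable_pi_apply i).snd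
  -- per-`ε` facts
  have hlam : ∀ ε ∈ S, 0 < lam ε := fun ε hε => hlmin.trans_le (hall ε hε).1
  have hB0 : 0 ≤ B := by
    obtain ⟨-, -, hpos, hle, -⟩ := hall 0 ⟨le_rfl, zero_le_one⟩
    exact (hpos (0, 0)).le.trans (hle (0, 0))
  have hMG0 : 0 ≤ MG := (hG0 η₀).trans (hGb η₀)
  have hdRm : ∀ ε ∈ S, Measurable (dR ε) := by
    intro ε hε
    obtain ⟨-, hhm, -, -, -⟩ := hall ε hε
    have hV : Measurable (pinnedChain ω₂ (a * ε) (b * ε) 1).V := by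
      show Measurable fun r : ℝ => r ^ 2 / 2 + b * ε * r ^ 4 / 4
      fun_prop
    have hU : Measurable (pinnedChain ω₂ (a * ε) (b * ε) 1).U := measurable_pinnedChain_U _ _ _ _
    rw [hdR]
    refine ((((hhm.comp (measurable_pi_apply a₀)).mul (hhm.comp (measurable_pi_apply _))).mul
      (Finset.measurable_prod _ fun j _ => ?_)).mul (Finset.measurable_prod _ fun j _ => ?_))
    · exact (Real.measurable_exp.comp ((hV.comp ((hq _).sub (hq _))).const_mul _)).mul_const _
    · exact Real.measurable_exp.comp ((((hp _).pow_const 2).div_const 2).add (hU.comp (hq _))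
        |>.const_mul _)
  have hdR0 : ∀ ε ∈ S, ∀ σ, 0 ≤ dR ε σ := by
    intro ε hε σ
    obtain ⟨-, -, hhpos, -, -⟩ := hall ε hε
    have := hlam ε hε
    rw [hdR]; dsimp only
    refine mul_nonneg (mul_nonneg (mul_nonneg (hhpos _).le (hhpos _).le)
      (Finset.prod_nonneg fun j _ => by positivity)) (Finset.prod_nonneg fun j _ => by positivity)
  have hdR_le : ∀ ε ∈ S, ∀ σ, dR ε σ ≤ B * B * lmin⁻¹ ^ n *
      ∏ j ∈ Finset.range (n + 1), w0r (σ (a₀ + j)) := by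
    intro ε hε σ
    obtain ⟨hlamε, -, hhpos, hhle, -⟩ := hall ε hε
    have hl := hlam ε hε
    rw [hdR]; dsimp only
    have h1 : ∏ j ∈ Finset.range n, Real.exp (-(1 : ℝ)⁻¹ * (pinnedChain ω₂ (a * ε) (b * ε) 1).V
        ((σ (a₀ + j + 1)).1 - (σ (a₀ + j)).1)) * (lam ε)⁻¹ ≤ lmin⁻¹ ^ n := by
      rw [← Finset.card_range n, ← Finset.prod_const, Finset.card_range]
      refine Finset.prod_le_prod (fun j _ => by positivity) fun j _ => ?_
      have e1 : Real.exp (-(1 : ℝ)⁻¹ * (pinnedChain ω₂ (a * ε) (b * ε) 1).V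
          ((σ (a₀ + j + 1)).1 - (σ (a₀ + j)).1)) ≤ 1 := by
        rw [Real.exp_le_one_iff]
        have : 0 ≤ (pinnedChain ω₂ (a * ε) (b * ε) 1).V ((σ (a₀ + j + 1)).1 - (σ (a₀ + j)).1) := by
          show (0 : ℝ) ≤ _ ^ 2 / 2 + b * ε * _ ^ 4 / 4
          have := mul_nonneg hb hε.1
          positivity
        nlinarith
      have e2 : (lam ε)⁻¹ ≤ lmin⁻¹ := (inv_le_inv₀ hl hlmin).2 hlamε
      calc _ ≤ 1 * lmin⁻¹ := mul_le_mul e1 e2 (inv_pos.2 hl).le zero_le_one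
        _ = lmin⁻¹ := one_mul _
    have h2 : ∏ j ∈ Finset.range (n + 1), Real.exp (-(1 : ℝ)⁻¹ * ((σ (a₀ + j)).2 ^ 2 / 2 +
        (pinnedChain ω₂ (a * ε) (b * ε) 1).U (σ (a₀ + j)).1)) ≤
        ∏ j ∈ Finset.range (n + 1), w0r (σ (a₀ + j)) := by
      refine Finset.prod_le_prod (fun j _ => (Real.exp_pos _).le) fun j _ => ?_
      rw [hw0r]; dsimp only
      refine Real.exp_le_exp.2 ?_
      have : (pinnedChain ω₂ 0 0 1).U (σ (a₀ + j)).1 ≤ (pinnedChain ω₂ (a * ε) (b * ε) 1).U (σ (a₀ + j)).1 := by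
        show ω₂ * _ ^ 2 / 2 + 0 * _ ^ 4 / 4 ≤ ω₂ * _ ^ 2 / 2 + a * ε * _ ^ 4 / 4
        have := mul_nonneg ha hε.1
        have : 0 ≤ (σ (a₀ + j)).1 ^ 4 := by positivity
        nlinarith
      nlinarith
    have h3 : 0 ≤ ∏ j ∈ Finset.range n, Real.exp (-(1 : ℝ)⁻¹ * (pinnedChain ω₂ (a * ε) (b * ε) 1).V
        ((σ (a₀ + j + 1)).1 - (σ (a₀ + j)).1)) * (lam ε)⁻¹ :=
      Finset.prod_nonneg fun j _ => by positivity
    have h4 : 0 ≤ ∏ j ∈ Finset.range (n + 1), Real.exp (-(1 : ℝ)⁻¹ * ((σ (a₀ + j)).2 ^ 2 / 2 +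
        (pinnedChain ω₂ (a * ε) (b * ε) 1).U (σ (a₀ + j)).1)) :=
      Finset.prod_nonneg fun j _ => (Real.exp_pos _).le
    exact mul_le_mul (mul_le_mul (mul_le_mul (hhle _) (hhle _) (hhpos _).le hB0) h1 h3
      (mul_nonneg hB0 hB0)) h2 h4 (by positivity)
  have hdRc : ∀ σ, ContinuousOn (fun ε => dR ε σ) S := by
    intro σ
    rw [hdR]
    refine (((hhc _).mul (hhc _)).mul (continuousOn_finsetProd _ fun j _ => ?_)).mul
      (continuousOn_finsetProd _ fun j _ => ?_)
    · refine ContinuousOn.mul (Continuous.continuousOn ?_) (hlamc.inv₀ fun ε hε => (hlam ε hε).ne')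
      show Continuous fun ε : ℝ => Real.exp (-(1 : ℝ)⁻¹ *
        (((σ (a₀ + j + 1)).1 - (σ (a₀ + j)).1) ^ 2 / 2 + b * ε * ((σ (a₀ + j + 1)).1 - (σ (a₀ + j)).1) ^ 4 / 4))
      fun_prop
    · refine Continuous.continuousOn ?_
      show Continuous fun ε : ℝ => Real.exp (-(1 : ℝ)⁻¹ * ((σ (a₀ + j)).2 ^ 2 / 2 +
        (ω₂ * (σ (a₀ + j)).1 ^ 2 / 2 + a * ε * (σ (a₀ + j)).1 ^ 4 / 4)))
      fun_prop
  -- the window formula in real-density form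
  have hrepr : ∀ ε ∈ S, ∫ σ, G σ ∂(μ ε) = (∫⁻ y, ENNReal.ofReal (G (updateFinset η₀ W y) *
      dR ε (updateFinset η₀ W y)) ∂(Measure.pi fun _ : ↥W => (volume : Measure (ℝ × ℝ)))).toReal := by
    intro ε hε
    obtain ⟨hG, hSI⟩ := hμ ε hε
    obtain ⟨hlamε, hhm, hhpos, hhle, hstate⟩ := hall ε hε
    obtain ⟨hwin, -⟩ := hstate (μ ε) hG hSI
    set P : OscillatorChain := pinnedChain ω₂ (a * ε) (b * ε) 1 with hP
    obtain ⟨k, hk⟩ : ∃ k : ℝ × ℝ → ℝ × ℝ → ℝ≥0∞, ∀ z z', k z z' =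
        ENNReal.ofReal (Real.exp (-(1 : ℝ)⁻¹ * P.V (z'.1 - z.1))) := ⟨_, fun _ _ => rfl⟩
    obtain ⟨φ, hφ⟩ : ∃ φ : ℝ × ℝ → ℝ≥0∞, ∀ z, φ z = ENNReal.ofReal (h ε z) := ⟨_, fun _ => rfl⟩
    obtain ⟨w, hw⟩ : ∃ w : ℝ × ℝ → ℝ≥0∞, ∀ z, w z =
        ENNReal.ofReal (Real.exp (-(1 : ℝ)⁻¹ * (z.2 ^ 2 / 2 + P.U z.1))) := ⟨_, fun _ => rfl⟩
    obtain ⟨L, hL⟩ : ∃ L : ℝ≥0∞, L = ENNReal.ofReal (lam ε) := ⟨_, rfl⟩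
    obtain ⟨D, hD⟩ : ∃ D : ℤ → ℕ → ChainConfig → ℝ≥0∞, ∀ a₁ n₁ σ, D a₁ n₁ σ = φ (σ a₁) * φ (σ (a₁ + n₁)) *
        (∏ j ∈ Finset.range n₁, k (σ (a₁ + j)) (σ (a₁ + j + 1)) * L⁻¹) *
        ∏ j ∈ Finset.range (n₁ + 1), w (σ (a₁ + j)) := ⟨_, fun _ _ _ => rfl⟩
    have hwindow := hwin k φ w L D hk hφ hw hL hD a₀ n _ hGm' hGdW η₀
    have hDR : ∀ σ, D a₀ n σ = ENNReal.ofReal (dR ε σ) := by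
      intro σ
      have hl := hlam ε hε
      rw [hD, hdR]; dsimp only
      rw [ENNReal.ofReal_mul (mul_nonneg (mul_nonneg (hhpos _).le (hhpos _).le)
          (Finset.prod_nonneg fun j _ => by positivity)),
        ENNReal.ofReal_mul (mul_nonneg (hhpos _).le (hhpos _).le),
        ENNReal.ofReal_mul (hhpos _).le,
        ENNReal.ofReal_prod_of_nonneg (fun j _ => by positivity),
        ENNReal.ofReal_prod_of_nonneg (fun j _ => (Real.exp_pos _).le)]
      simp only [hφ, hk, hw, hL]
      congr 2
      refine Finset.prod_congr rfl fun j _ => ?_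
      rw [ENNReal.ofReal_mul (Real.exp_pos _).le, ENNReal.ofReal_inv_of_pos hl]
    have e1 : ∫ σ, G σ ∂(μ ε) = (∫⁻ σ, ENNReal.ofReal (G σ) ∂(μ ε)).toReal :=
      integral_eq_lintegral_of_nonneg_ae (Eventually.of_forall hG0) hGm.aestronglyMeasurable
    rw [e1, hwindow, lmarginal]
    congr 1
    refine lintegral_congr fun y => ?_
    rw [hDR, ← ENNReal.ofReal_mul (hG0 _)]
  -- continuity of the real-density form (dominated convergence)
  have hcont : ContinuousOn (fun ε => (∫⁻ y, ENNReal.ofReal (G (updateFinset η₀ W y) *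
      dR ε (updateFinset η₀ W y)) ∂(Measure.pi fun _ : ↥W => (volume : Measure (ℝ × ℝ)))).toReal) S := by
    intro ε₀ hε₀
    set bound : (↥W → ℝ × ℝ) → ℝ≥0∞ := fun y => ENNReal.ofReal (MG * (B * B * lmin⁻¹ ^ n)) *
      ∏ j ∈ Finset.range (n + 1), w0 ((updateFinset η₀ W y) (a₀ + j)) with hbound
    have hupd : Measurable (updateFinset η₀ W : (↥W → ℝ × ℝ) → ChainConfig) := measurable_updateFinset
    have hprodσ : Measurable fun σ : ChainConfig => ∏ j ∈ Finset.range (n + 1), w0 (σ (a₀ + j)) :=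
      Finset.measurable_prod _ fun j _ => hw0m.comp (measurable_pi_apply _)
    have hprodm : Measurable fun y : ↥W → ℝ × ℝ =>
        ∏ j ∈ Finset.range (n + 1), w0 ((updateFinset η₀ W y) (a₀ + j)) := hprodσ.comp hupd
    have hfin : ∫⁻ y, bound y ∂(Measure.pi fun _ : ↥W => (volume : Measure (ℝ × ℝ))) ≠ ∞ := by
      rw [hbound, lintegral_const_mul _ hprodm]
      have hprod : ∫⁻ y, (∏ j ∈ Finset.range (n + 1), w0 ((updateFinset η₀ W y) (a₀ + j)))
          ∂(Measure.pi fun _ : ↥W => (volume : Measure (ℝ × ℝ))) = (∫⁻ z, w0 z) ^ (n + 1) :=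
        lmarginal_prod_range hw0m a₀ n η₀
      rw [hprod]
      exact ENNReal.mul_ne_top ENNReal.ofReal_ne_top (ENNReal.pow_ne_top hw0i)
    have hT : Tendsto (fun ε => ∫⁻ y, ENNReal.ofReal (G (updateFinset η₀ W y) *
        dR ε (updateFinset η₀ W y)) ∂(Measure.pi fun _ : ↥W => (volume : Measure (ℝ × ℝ))))
        (𝓝[S] ε₀) (𝓝 (∫⁻ y, ENNReal.ofReal (G (updateFinset η₀ W y) *
        dR ε₀ (updateFinset η₀ W y)) ∂(Measure.pi fun _ : ↥W => (volume : Measure (ℝ × ℝ))))) := by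
      refine tendsto_lintegral_filter_of_dominated_convergence bound ?_ ?_ hfin
        (ae_of_all _ fun y => ?_)
      · filter_upwards [self_mem_nhdsWithin] with ε hε
        exact ENNReal.measurable_ofReal.comp ((hGm.comp measurable_updateFinset).mul
          ((hdRm ε hε).comp measurable_updateFinset))
      · filter_upwards [self_mem_nhdsWithin] with ε hε
        refine ae_of_all _ fun y => ?_
        rw [hbound]; dsimp only
        rw [hw0]
        rw [← ENNReal.ofReal_prod_of_nonneg (fun j _ => (Real.exp_pos _).le),
          ← ENNReal.ofReal_mul (by positivity)]
        refine ENNReal.ofReal_le_ofReal ?_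
        have h1 := hdR_le ε hε (updateFinset η₀ W y)
        have h2 := hGb (updateFinset η₀ W y)
        have h3 := hG0 (updateFinset η₀ W y)
        have h4 := hdR0 ε hε (updateFinset η₀ W y)
        calc G (updateFinset η₀ W y) * dR ε (updateFinset η₀ W y)
            ≤ MG * (B * B * lmin⁻¹ ^ n * ∏ j ∈ Finset.range (n + 1), w0r ((updateFinset η₀ W y) (a₀ + j))) :=
              mul_le_mul h2 h1 h4 (h3.trans h2)
          _ = MG * (B * B * lmin⁻¹ ^ n) * ∏ j ∈ Finset.range (n + 1), w0r ((updateFinset η₀ W y) (a₀ + j)) := by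
              ring
      · exact (ENNReal.continuous_ofReal.continuousAt.comp_continuousWithinAt
          (continuousWithinAt_const.mul ((hdRc _).continuousWithinAt hε₀))).tendsto
    have hfin₀ : ∫⁻ y, ENNReal.ofReal (G (updateFinset η₀ W y) * dR ε₀ (updateFinset η₀ W y))
        ∂(Measure.pi fun _ : ↥W => (volume : Measure (ℝ × ℝ))) ≠ ∞ := by
      refine ne_top_of_le_ne_top hfin (lintegral_mono fun y => ?_)
      rw [hbound]; dsimp only
      rw [hw0]
      rw [← ENNReal.ofReal_prod_of_nonneg (fun j _ => (Real.exp_pos _).le),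
        ← ENNReal.ofReal_mul (by positivity)]
      refine ENNReal.ofReal_le_ofReal ?_
      have h1 := hdR_le ε₀ hε₀ (updateFinset η₀ W y)
      have h2 := hGb (updateFinset η₀ W y)
      have h3 := hG0 (updateFinset η₀ W y)
      have h4 := hdR0 ε₀ hε₀ (updateFinset η₀ W y)
      calc G (updateFinset η₀ W y) * dR ε₀ (updateFinset η₀ W y)
          ≤ MG * (B * B * lmin⁻¹ ^ n * ∏ j ∈ Finset.range (n + 1), w0r ((updateFinset η₀ W y) (a₀ + j))) :=
            mul_le_mul h2 h1 h4 (h3.trans h2)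
        _ = MG * (B * B * lmin⁻¹ ^ n) * ∏ j ∈ Finset.range (n + 1), w0r ((updateFinset η₀ W y) (a₀ + j)) := by
            ring
    have hfinal := (ENNReal.tendsto_toReal hfin₀).comp hT
    exact hfinal
  exact hcont.congr (fun ε hε => hrepr ε hε)

/-- **Expectations of local polynomials are continuous in the coupling** (named-hypotheses form of
the registered `pencil_expectation_continuous`). [folklore] -/
theorem pencil_expectation_continuous' {ω₂ a b : ℝ} (hω : 0 < ω₂) (ha : 0 ≤ a) (hb : 0 ≤ b)
    {μ : ℝ → Measure ChainConfig}
    (hμ : ∀ ε ∈ Set.Icc (0 : ℝ) 1, (pinnedChain ω₂ (a * ε) (b * ε) 1).IsChainGibbsMeasure 1 (μ ε) ∧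
      IsShiftInvariant (μ ε))
    {F : ChainConfig → ℝ} (hF : F ∈ Algebra.adjoin ℝ (Set.range fun xc : ℤ × Bool =>
      fun σ : ChainConfig => if xc.2 then (σ xc.1).2 else (σ xc.1).1)) :
    ContinuousOn (fun ε => ∫ σ, F σ ∂(μ ε)) (Set.Icc 0 1) := by
  obtain ⟨hFm, hmom⟩ := pencil_uniform_moments' hω ha hb hμ hF
  obtain ⟨R, hFd⟩ := exists_dependsOn_of_mem_polyObs hF
  obtain ⟨M₁, hM₁⟩ := hmom 1
  obtain ⟨M₂, hM₂⟩ := hmom 2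
  have hprob : ∀ ε ∈ Set.Icc (0 : ℝ) 1, IsProbabilityMeasure (μ ε) := fun ε hε => (hμ ε hε).1.1
  -- the truncations
  set G : ℕ → ChainConfig → ℝ := fun N σ => max (-((N : ℝ) + 1)) (min (F σ) ((N : ℝ) + 1)) with hG
  have hGm : ∀ N, Measurable (G N) := fun N => measurable_const.max (hFm.min measurable_const)
  have hGd : ∀ N, DependsOn (G N) (Set.Icc (-(R : ℤ)) R) := fun N σ τ hστ => by
    rw [hG]; dsimp only; rw [hFd hστ]
  have hGb : ∀ N σ, |G N σ| ≤ (N : ℝ) + 1 := fun N σ => by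
    rw [hG, abs_le]
    exact ⟨le_max_left _ _, max_le (by linarith) (min_le_right _ _)⟩
  -- (A) each truncated expectation is continuous
  have hcontN : ∀ N, ContinuousOn (fun ε => ∫ σ, G N σ ∂(μ ε)) (Set.Icc 0 1) := by
    intro N
    have h1 := continuousOn_integral_of_bounded hω ha hb hμ (G := fun σ => G N σ + ((N : ℝ) + 1))
      (R := R) (MG := ((N : ℝ) + 1) + ((N : ℝ) + 1)) ((hGm N).add_const _)
      (fun σ τ hστ => by beta_reduce; rw [hGd N hστ])
      (fun σ => by have := (abs_le.1 (hGb N σ)).1; linarith)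
      (fun σ => by have := (abs_le.1 (hGb N σ)).2; linarith)
    have h2 : ∀ ε ∈ Set.Icc (0 : ℝ) 1, ∫ σ, G N σ ∂(μ ε) =
        (∫ σ, (G N σ + ((N : ℝ) + 1)) ∂(μ ε)) - ((N : ℝ) + 1) := by
      intro ε hε
      haveI := hprob ε hε
      have hint : Integrable (G N) (μ ε) := Integrable.of_bound (hGm N).aestronglyMeasurable
        ((N : ℝ) + 1) (Eventually.of_forall fun σ => by rw [Real.norm_eq_abs]; exact hGb N σ)
      rw [integral_add hint (integrable_const _), integral_const, smul_eq_mul, probReal_univ,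
        one_mul, add_sub_cancel_right]
    exact (h1.sub continuousOn_const).congr h2
  -- (B) uniform approximation
  have happrox : ∀ N, ∀ ε ∈ Set.Icc (0 : ℝ) 1,
      dist (∫ σ, F σ ∂(μ ε)) (∫ σ, G N σ ∂(μ ε)) ≤ M₂ / ((N : ℝ) + 1) := by
    intro N ε hε
    haveI := hprob ε hε
    obtain ⟨hi1, -⟩ := hM₁ ε hε
    obtain ⟨hi2, hl2⟩ := hM₂ ε hε
    have hFi : Integrable F (μ ε) := by
      refine hi1.mono' hFm.aestronglyMeasurable (Eventually.of_forall fun σ => ?_)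
      rw [pow_one, Real.norm_eq_abs]
    have hGi : Integrable (G N) (μ ε) := Integrable.of_bound (hGm N).aestronglyMeasurable
      ((N : ℝ) + 1) (Eventually.of_forall fun σ => by rw [Real.norm_eq_abs]; exact hGb N σ)
    have hN : (0 : ℝ) < (N : ℝ) + 1 := by positivity
    rw [Real.dist_eq, ← integral_sub hFi hGi]
    calc |∫ σ, (F σ - G N σ) ∂(μ ε)| ≤ ∫ σ, |F σ - G N σ| ∂(μ ε) := abs_integral_le_integral_abs
      _ ≤ ∫ σ, |F σ| ^ 2 / ((N : ℝ) + 1) ∂(μ ε) := by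
          refine integral_mono_of_nonneg (Eventually.of_forall fun σ => abs_nonneg _)
            (hi2.div_const _) (Eventually.of_forall fun σ => ?_)
          exact abs_sub_clamp_le (F σ) hN
      _ = (∫ σ, |F σ| ^ 2 ∂(μ ε)) / ((N : ℝ) + 1) := integral_div _ _
      _ ≤ M₂ / ((N : ℝ) + 1) := div_le_div_of_nonneg_right hl2 hN.le
  have hunif : TendstoUniformlyOn (fun N ε => ∫ σ, G N σ ∂(μ ε)) (fun ε => ∫ σ, F σ ∂(μ ε)) atTop
      (Set.Icc 0 1) := by
    rw [Metric.tendstoUniformlyOn_iff]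
    intro δ hδ
    have h1 : Tendsto (fun N : ℕ => (N : ℝ) + 1) atTop atTop :=
      tendsto_natCast_atTop_atTop.atTop_add tendsto_const_nhds
    have hlim : Tendsto (fun N : ℕ => M₂ / ((N : ℝ) + 1)) atTop (𝓝 0) :=
      tendsto_const_nhds.div_atTop h1
    filter_upwards [(tendsto_order.1 hlim).2 δ hδ] with N hN
    intro ε hε
    exact (happrox N ε hε).trans_lt hN
  exact hunif.continuousOn (Eventually.of_forall hcontN).frequently

/-- **Expectations of local polynomials are continuous in the coupling** (registered sub-goal of
stub G; see `pencil_expectation_continuous'`). [folklore] -/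
theorem pencil_expectation_continuous : ∀ ω₂ a b : ℝ, 0 < ω₂ → 0 ≤ a → 0 ≤ b →
    ∀ μ : ℝ → MeasureTheory.Measure Literature.MathematicalPhysics.KineticTheory.HeatConduction.ChainConfig,
      (∀ ε ∈ Set.Icc (0 : ℝ) 1,
        (Literature.MathematicalPhysics.KineticTheory.HeatConduction.pinnedChain
          ω₂ (a * ε) (b * ε) 1).IsChainGibbsMeasure 1 (μ ε) ∧
        Literature.MathematicalPhysics.KineticTheory.HeatConduction.IsShiftInvariant (μ ε)) →
      ∀ F ∈ Algebra.adjoin ℝ (Set.range fun xc : ℤ × Bool =>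
        fun σ : Literature.MathematicalPhysics.KineticTheory.HeatConduction.ChainConfig =>
          if xc.2 then (σ xc.1).2 else (σ xc.1).1),
      ContinuousOn (fun ε => ∫ σ, F σ ∂(μ ε)) (Set.Icc 0 1) :=
  fun _ _ _ hω ha hb _ hμ _ hF => pencil_expectation_continuous' hω ha hb hμ hF

end Summit.AtomisticToContinuum.FouriersLaw.Theorems.DrudeDissolution.GramPencilHarmonicChaos

end
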